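import Summits.AtomisticToContinuum.HydrodynamicLimit.Theorems.RelayRaceLocalityLightConeInLawSketchLine

/-!
# Pseudo-distance calculus for the domain-of-dependence leg of the line `Sketch`
(crux `LightConeInLaw`, stmt-AtomisticToContinuum-12500; route `RelayRaceLocality`,
sub-problem `HydrodynamicLimit`)

The globally smooth pseudo-distance on the flat `3`-torus `T3` centred at `y`,
`Q_y(x) = ∑ i, sin (π ‖(x - y) i‖) ^ 2` (`‖·‖` the quotient norm of `UnitAddCircle`,
`‖(a : UnitAddCircle)‖ = |a - round a| ≤ 1/2`), written inline throughout (no definition).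
Four registered stubs of the cone-weighted energy method:

* `four_mul_euclidDist_sq_le_qdist` : `4 d(x,y)² ≤ Q_y(x)` (Jordan's inequality coordinatewise,
  `d` the minimal-image distance `Torus.euclidDist`);
* `isSmooth_qdist` : `Q_y` is smooth on the whole torus (its periodic lift is
  `v ↦ ∑ i, sin² (π (v i - reprSym y i))`);
* `hasDerivAt_qdist_coordLine` : the derivative of `Q_y` along the `i`-th coordinate line through
  `x`, at `x`, is `π sin (2π reprSym (x - y) i)`;
* `sum_sq_partialDeriv_qdist_le` : `|∇Q_y|² ≤ 4π² Q_y`.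

The common tool is `sin_sq_pi_mul_norm_coe` : `sin² (π ‖(a : UnitAddCircle)‖) = sin² (π a)`
(`sin² (π ·)` is even and `1`-periodic).
-/

namespace Summit.AtomisticToContinuum.HydrodynamicLimit.Theorems.LightConeInLawSketch.DoD

open scoped BigOperators Topology Classical ENNReal
open Filter Set MeasureTheory
open Literature.MathematicalPhysics.KineticTheory Literature.Analysis.FluidPDE
  Literature.Analysis.FunctionSpaces

noncomputable section

/-! ### One-dimensional trigonometric helpers -/

/-- `sin² (π |b|) = sin² (π b)` (evenness of `sin²`). -/
theorem sin_sq_pi_mul_abs (b : ℝ) :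
    Real.sin (Real.pi * |b|) ^ 2 = Real.sin (Real.pi * b) ^ 2 := by
  rcases abs_choice b with h | h
  · rw [h]
  · rw [h, mul_neg, Real.sin_neg, neg_sq]

/-- `sin² (π (b - n)) = sin² (π b)` for an integer `n` (`1`-periodicity of `sin² (π ·)`). -/
theorem sin_sq_pi_mul_sub_int (b : ℝ) (n : ℤ) :
    Real.sin (Real.pi * (b - n)) ^ 2 = Real.sin (Real.pi * b) ^ 2 := by
  rw [Real.sin_sq_eq_half_sub, Real.sin_sq_eq_half_sub,
    show 2 * (Real.pi * (b - n)) = 2 * (Real.pi * b) - n * (2 * Real.pi) by ring,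
    Real.cos_sub_int_mul_two_pi]

/-- The quotient norm of `UnitAddCircle` seen through `sin² (π ·)`:
`sin² (π ‖(a : UnitAddCircle)‖) = sin² (π a)` (`‖(a : UnitAddCircle)‖ = |a - round a|`). -/
theorem sin_sq_pi_mul_norm_coe (a : ℝ) :
    Real.sin (Real.pi * ‖((a : ℝ) : UnitAddCircle)‖) ^ 2 = Real.sin (Real.pi * a) ^ 2 := by
  rw [UnitAddCircle.norm_eq, sin_sq_pi_mul_abs, sin_sq_pi_mul_sub_int]

/-- Jordan's inequality on the half period: `4 a² ≤ sin² (π a)` for `0 ≤ a ≤ 1/2`. -/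
theorem four_mul_sq_le_sin_sq {a : ℝ} (h0 : 0 ≤ a) (h1 : a ≤ 1 / 2) :
    4 * a ^ 2 ≤ Real.sin (Real.pi * a) ^ 2 := by
  have hj : 2 * a ≤ Real.sin (Real.pi * a) := by
    have h := Real.mul_le_sin (x := Real.pi * a) (by positivity)
      (by nlinarith [Real.pi_pos])
    rwa [← mul_assoc, div_mul_cancel₀ (2 : ℝ) Real.pi_ne_zero] at h
  calc 4 * a ^ 2 = (2 * a) ^ 2 := by ring
    _ ≤ Real.sin (Real.pi * a) ^ 2 := pow_le_pow_left₀ (by positivity) hj 2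

/-- `(π sin (2πa))² ≤ 4π² sin² (πa)` (double angle and `cos² ≤ 1`). -/
theorem sq_pi_mul_sin_two_pi_mul_le (a : ℝ) :
    (Real.pi * Real.sin (2 * Real.pi * a)) ^ 2 ≤
      4 * Real.pi ^ 2 * Real.sin (Real.pi * a) ^ 2 := by
  rw [show 2 * Real.pi * a = 2 * (Real.pi * a) by ring, Real.sin_two_mul]
  have key : 0 ≤ (1 - Real.cos (Real.pi * a) ^ 2) * (Real.pi * Real.sin (Real.pi * a)) ^ 2 :=
    mul_nonneg (sub_nonneg.2 (Real.cos_sq_le_one _)) (sq_nonneg _)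
  nlinarith [key]

/-- The derivative at `s = 0` of `s ↦ sin² (π (a + s c))` is `c · π sin (2πa)`. -/
theorem hasDerivAt_sin_sq_line (a c : ℝ) :
    HasDerivAt (fun s : ℝ => Real.sin (Real.pi * (a + s * c)) ^ 2)
      (c * (Real.pi * Real.sin (2 * Real.pi * a))) 0 := by
  have h1 : HasDerivAt (fun s : ℝ => Real.pi * (a + s * c)) (Real.pi * (1 * c)) 0 :=
    (((hasDerivAt_id (0 : ℝ)).mul_const c).const_add a).const_mul Real.pi
  have h2 := ((Real.hasDerivAt_sin _).comp (0 : ℝ) h1).fun_pow 2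
  refine h2.congr_deriv ?_
  rw [show 2 * Real.pi * a = 2 * (Real.pi * a) by ring, Real.sin_two_mul]
  simp only [Function.comp_apply, zero_mul, add_zero, one_mul]
  norm_num
  ring

/-! ### The four stubs -/

/-- **Stub `four_mul_euclidDist_sq_le_qdist`.** The pseudo-distance dominates four times the
squared minimal-image distance: `4 d(x,y)² ≤ ∑ i, sin² (π ‖(x - y) i‖)` (coordinatewise Jordan:
`2a ≤ sin (πa)` on `[0, 1/2]`, with `a = ‖(x - y) i‖ = |reprSym (x - y) i| ≤ 1/2`). -/
theorem four_mul_euclidDist_sq_le_qdist : ∀ x y : T3,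
    4 * Torus.euclidDist x y ^ 2 ≤ ∑ i : Fin 3, Real.sin (Real.pi * ‖(x - y) i‖) ^ 2 := by
  intro x y
  rw [Torus.euclidDist_eq, EuclideanSpace.norm_sq_eq, Finset.mul_sum]
  refine Finset.sum_le_sum fun i _ => ?_
  rw [Real.norm_eq_abs, Torus.abs_reprSym_apply]
  refine four_mul_sq_le_sin_sq (norm_nonneg _) ?_
  have h := AddCircle.norm_le_half_period (1 : ℝ) (x := (x - y) i) one_ne_zero
  rwa [abs_one] at h

/-- **Stub `isSmooth_qdist`.** The pseudo-distance is smooth on the whole torus: its periodic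
lift is `v ↦ ∑ i, sin² (π (v i - reprSym y i))`, a finite sum of squares of sines of affine
functions. -/
theorem isSmooth_qdist : ∀ y : T3,
    Torus.IsSmooth (fun x : T3 => ∑ i : Fin 3, Real.sin (Real.pi * ‖(x - y) i‖) ^ 2) := by
  intro y
  have hfun : Torus.lift (fun x : T3 => ∑ i : Fin 3, Real.sin (Real.pi * ‖(x - y) i‖) ^ 2) =
      fun v : EuclideanSpace ℝ (Fin 3) =>
        ∑ i : Fin 3, Real.sin (Real.pi * (v i - Torus.reprSym y i)) ^ 2 := by
    funext v
    rw [Torus.lift_apply]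
    refine Finset.sum_congr rfl fun i _ => ?_
    have hy : y i = ((Torus.reprSym y i : ℝ) : UnitAddCircle) :=
      (congrFun (Torus.proj_reprSym y) i).symm
    rw [Pi.sub_apply, Torus.proj_apply, hy, ← AddCircle.coe_sub, sin_sq_pi_mul_norm_coe]
  unfold Torus.IsSmooth
  rw [hfun]
  exact ContDiff.sum fun i _ => ((contDiff_const.mul
    ((contDiff_piLp_apply (p := 2) (i := i)).sub contDiff_const)).sin).pow 2

/-- **Stub `hasDerivAt_qdist_coordLine`.** The derivative of the pseudo-distance along the
`i`-th coordinate line through `x`, at `x`, is `π sin (2π reprSym (x - y) i)`: along the line the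
`j`-th coordinate of `x + proj (s eᵢ) - y` is `↑(reprSym (x - y) j + s δᵢⱼ)`, so the `j`-th term
is `sin² (π (reprSym (x - y) j + s δᵢⱼ))`, with derivative `δᵢⱼ π sin (2π reprSym (x - y) j)`. -/
theorem hasDerivAt_qdist_coordLine : ∀ (y x : T3) (i : Fin 3),
    HasDerivAt (fun s : ℝ => ∑ j : Fin 3,
      Real.sin (Real.pi * ‖(x + Torus.proj (s • EuclideanSpace.single i (1 : ℝ)) - y) j‖) ^ 2)
      (Real.pi * Real.sin (2 * Real.pi * Torus.reprSym (x - y) i)) 0 := by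
  intro y x i
  have hcoord : ∀ (s : ℝ) (j : Fin 3),
      (x + Torus.proj (s • EuclideanSpace.single i (1 : ℝ)) - y) j =
        ((Torus.reprSym (x - y) j + s * EuclideanSpace.single i (1 : ℝ) j : ℝ) :
          UnitAddCircle) := by
    intro s j
    have hxy : (x - y) j = ((Torus.reprSym (x - y) j : ℝ) : UnitAddCircle) :=
      (congrFun (Torus.proj_reprSym (x - y)) j).symm
    rw [add_sub_right_comm, Pi.add_apply, hxy, Torus.proj_smul_apply, ← AddCircle.coe_add]
  have hfun : (fun s : ℝ => ∑ j : Fin 3,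
      Real.sin (Real.pi * ‖(x + Torus.proj (s • EuclideanSpace.single i (1 : ℝ)) - y) j‖) ^ 2) =
      fun s : ℝ => ∑ j : Fin 3, Real.sin (Real.pi *
        (Torus.reprSym (x - y) j + s * EuclideanSpace.single i (1 : ℝ) j)) ^ 2 := by
    funext s
    exact Finset.sum_congr rfl fun j _ => by rw [hcoord, sin_sq_pi_mul_norm_coe]
  rw [hfun]
  have hsum := HasDerivAt.fun_sum (u := Finset.univ) fun j _ =>
    hasDerivAt_sin_sq_line (Torus.reprSym (x - y) j) (EuclideanSpace.single i (1 : ℝ) j)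
  refine hsum.congr_deriv ?_
  rw [Finset.sum_eq_single i
    (fun j _ hj => by
      rw [show EuclideanSpace.single i (1 : ℝ) j = 0 from PiLp.single_eq_of_ne _ hj _,
        zero_mul])
    (fun h => absurd (Finset.mem_univ i) h),
    show EuclideanSpace.single i (1 : ℝ) i = 1 from PiLp.single_eq_same _ i _, one_mul]

/-- **Stub `sum_sq_partialDeriv_qdist_le`.** Gradient bound `|∇Q_y|² ≤ 4π² Q_y`: coordinatewise
`(π sin (2πr))² = 4π² sin² (πr) cos² (πr) ≤ 4π² sin² (πr)` and `sin² (π r) = sin² (π ‖(x - y) i‖)`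
for `r = reprSym (x - y) i`, `|r| = ‖(x - y) i‖`. -/
theorem sum_sq_partialDeriv_qdist_le : ∀ x y : T3,
    ∑ i : Fin 3, (Real.pi * Real.sin (2 * Real.pi * Torus.reprSym (x - y) i)) ^ 2 ≤
      4 * Real.pi ^ 2 * ∑ i : Fin 3, Real.sin (Real.pi * ‖(x - y) i‖) ^ 2 := by
  intro x y
  rw [Finset.mul_sum]
  refine Finset.sum_le_sum fun i _ => ?_
  rw [← Torus.abs_reprSym_apply, sin_sq_pi_mul_abs]
  exact sq_pi_mul_sin_two_pi_mul_le _

end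

end Summit.AtomisticToContinuum.HydrodynamicLimit.Theorems.LightConeInLawSketch.DoD
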